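import Summits.QuantumFields.YangMills.Theorems.BalabanUVNodesN11Sect3SupplyChainBorelBObligationsOfSolvable
import Summits.QuantumFields.YangMills.Theorems.BalabanUVNodesN11NoExpansionTStepZhPinOfBgFact

/-!
# DAG node N11 — THE BorelB ROAD WITHOUT THE RUN GUARD: (γ′) the same-witness no-expansion clause (dag-n11-d p605244), its every-level glue and this seat's
# `NoExpansionObligation` ∕ `SupplyChainAt` faces (p607459 §2–§3) KEYED ON THE bg FACTS OF THE RUN — `∀ k ≤ K, BgProvisoΛ … k (suppOfRecord₁₃SepCoP …) (UbgOfRecord₁₃CoP …)` —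
# in place of `(Provisos₁₃SepCoPH.bg, PartCompat₁₃)`, with the cube cover from `L·M₂ ∣ M`, `M = L^a` (dag-n11-w4): NO `PartCompat₁₃` ANYWHERE IN N11's NO-EXPANSION HALF

HEADER — WORK-UNIT METADATA.  Cell `pub-ymgap`, YM-PLAN Track A (HUMAN RULING D-0062 ∕ D-0149 width seats), seat `pub-ymgap-dag-n11-w1` (g3; WIDTH SEAT 1 of 4 on NODE n11
[B14]), route `BalabanUVNodes` rev 27 (Variant R), KEY item K1⁸ `StabilityBRunRowsAtRecordR13SepCoPH` = stmt-QuantumFields-26907 (helper lane, `--kind proof --supports 26907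
--as helper`, count-neutral).  Third file of dag-n11-d g15's HAND-OUT (o5) (pub-ymgap INBOX 2026-08-28T09:07Z), on this seat's own road.  [III] = [Balaban1988Convergent],
[15] = [Balaban1985Variational], [IV] = [Balaban1989LargeFieldI].  Over this seat's `…N11ChargedSepFacesOfBgFact` ∕ `…N11NoExpansionTStepZhPinOfBgFact` (the bg-fact editions two
and one layer down), dag-n11-d's `…SpaceTruncationSameWitnessFibre` (`clause_succ_sameWitness_of_hasSect2FormAtZS_of_borelB_of_bgReadChargedFibre`), `…SameWitnessZhPinOfSolvable`
(p605244: the (γ′) face and `mem_suppOfRecord₁₃SepCoP_of_sep_of_top_of_fibre`, `seqSeparated_of_slotsTOfRecord₁₃_succ_ne_zero_of_M₁_le_M`), `…NoExpansionTStepZhPinOfSolvable`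
(`regOn_cutSel_of_zhPin_of_solvable`), `…ChargedSepJunctionFibre` ∕ `…OfSolvableFibre`, `…ChiTopRegularity`, this seat's A `…Sect3SupplyChainBorelBObligationsOfSolvable` (p607459:
§1 `clause_succ_sameWitness_zero_…` — level 0, guard-free already — and the Gaussian-class dischargers), `…GaussianCertificateRows`, `…AFibreDominationOfCoercive`, dag-n11-w4's
`…OneBlockLevels` (p618164: `cover_row_of_nesting_of_powM`).

WHY THIS FILE.  The BorelB road (this seat's files I–VIII) delivers N11's one-token residual `SupplyChainAt θ p` at any Gaussian-class `θ` from `SupplierBorel`, K0's rows and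
the run's structure; it read the run guard `PartCompat₁₃ θ p K` (a range restriction on runs, [III] p. 257; dag-n11-w4 g4: a floor on the last coupling, its ∀-window binder
unsatisfiable) in two places only — dag-n11-d's record row `Provisos₁₃SepCoPH.bg … hPC` and the cube cover.  With `…ChargedSepFacesOfBgFact` ∕ `…NoExpansionTStepZhPinOfBgFact`
below, THIS FILE finishes the re-key on the road itself: (§1) p605244's (γ′) at levels `k ≥ 1` from the bg FACTS at `k` and `k+1` + the guard-free cover (proof = p605244's with
the substitutions; the window at `k+1` is no longer read); (§2) the every-level glue (level `0` needs neither); (§3) `NoExpansionObligation` and `SupplyChainAt` at a Gaussian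
certificate from `SupplierBorel` + the bg facts of the run `hbgs : ∀ k ≤ K, BgProvisoΛ … k …` + `L·M₂ ∣ M`, `M = L^a` + the other rows — NO `PartCompat₁₃` anywhere.  On
compatible runs `hbgs k hk := h.bg p k hk (window) (guard)` recovers A §3; below the floor the road now states exactly what it needs: [III] (2.28) ∕ [15] Thm 1's content at
the record's collar-class background, level by level (K0 ∕ def-R ∕ the plan's repair (ii)).

WHAT THIS FILE PROVES (4 theorems, 0 `def`, 0 `sorry`; standard axioms; conclusions VERBATIM the originals').
§1 ★★★ `clause_succ_sameWitness_of_hasSect2FormAtZS_of_borelB_of_zhPin_of_solvable_of_bgFact_of_powM`.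
§2 ★★★ `clause_succ_sameWitness_of_hasSect2FormAtZS_of_borelB_of_zhPin_of_solvable_all_of_bgFact_of_powM`.
§3 ★★★★ `noExpansionObligation_of_gaussCert_of_supplierBorel_of_bgFacts_of_powM` · ★★★★ `supplyChainAt_of_gaussCert_of_supplierBorel_of_bgFacts_of_powM`.

HONEST FRAMING.  Helper lane of K1⁸, count-neutral KERNEL BOOKKEEPING (argument substitution in landed theorems; p605244's proof lines and p607459's reused with the
substitutions, nothing else of dag-n11-d's re-typed); the bg facts ([III] (2.28) ∕ [15] Thm 1 content), K0's solvability, `2 ≤ cR` (uninhabited at the witnesses of record),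
`SupplierBorel`, the numerics are DISPLAYED HYPOTHESES; nothing of Bałaban asserted; no claim about which runs carry the bg facts.  N11 NOT discharged; K1⁸ ∕ K1⁷ NOT closed, no
registered stub touched; counts unmoved (typed 28∕28 · discharged 5∕27).  One finite `𝕋⁴_{L^K}` programme at fixed `ε = L^{−K}`; R4 closes only the conditional finite-𝕋⁴ rung
`BalabanLadder.UV` — NOT ℝ⁴, NOT OS, NOT a mass gap, NOT Clay.  No `sorry`, no `axiom`, no `def`, no `instance`, no `notation`.
Sources (SHAPE only): [III] Theorem p.245, Thm 1 p.262, §3 p.279, (2.1)–(2.2) pp.254–255, (2.5) p.255, (2.7) p.255, (2.10) p.256, (2.16)–(2.18) p.257, p.257 («compatible»),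
(2.20)–(2.28) pp.258–259, (2.41)–(2.42) p.261, (3.5) p.265, (3.16) p.268, (3.24)–(3.25) p.270; [15] Thm 1 (7)–(8) pp.278–279; [IV] (0.2)–(0.3) p.176.
-/

noncomputable section

open MeasureTheory
open scoped BigOperators ENNReal NNReal Matrix.Norms.L2Operator

namespace Summit.QuantumFields.YangMills.Theorems.BalabanUVNodesN11Sect3SupplyChainBorelBOfBgFacts

open Literature.MathematicalPhysics.QuantumFieldTheory.Balaban1983to89 T4Continuum T4NestedCovariance Node00 Node00.Tk DagBinding
open B15DeterminingSets B8Eq17ClassAkV1 B14.Eq218Concrete B10Eq42TorusConstraint Step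
open B14.Eq213MaximalDomains (side)
open B14.Eq213DetSet (Bj)
open Literature.MathematicalPhysics.QuantumFieldTheory.BalabanImbrieJaffe1984to88.BIJ85Eq453GaugeField (qsstarGIter0)
open BalabanUVNodesN11FluctTruncationDefs (IsFluctLocal)
open BalabanUVNodesN11SpaceTruncationDefs BalabanUVNodesN11SpaceTruncationBorelBDefs
open BalabanUVNodesN11HistoryPinnedResidualDefs BalabanUVNodesN11RePinnedParamDefs
open B14SeparationOfRecord (separated_of_slotsTOfRecord₁₃_succ_ne_zero seqSeparated_of_hullD gridClause_of_M₁_le_M)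
open BalabanUVNodesN11ChiTopRegularity (plaqSmallOn_genSet_top_of_chiSeqOfRecord_ne_zero_of_solvable)
open BalabanUVNodesN11Data7OnFibre (dataSmall7PTop_of_read_of_top_of_fibre)
open BalabanUVNodesN11ChargedSepJunctionFibre (bgProvisoΛ_chargedFibre_of_sep_of_junctionFibre)
open BalabanUVNodesN11ChargedSepJunctionOfSolvableFibre (sepJunctionChargedFibre_of_solvable)
open BalabanUVNodesN11ReadRegRePinned (sep_setOf_eq_of)
open BalabanUVNodesN11NoExpansionTStepZhPinOfSolvable (regOn_cutSel_of_zhPin_of_solvable)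
open BalabanUVNodesN11SpaceTruncationSameWitnessFibre (clause_succ_sameWitness_of_hasSect2FormAtZS_of_borelB_of_bgReadChargedFibre)
open BalabanUVNodesN11SameWitnessZhPinOfSolvable (mem_suppOfRecord₁₃SepCoP_of_sep_of_top_of_fibre seqSeparated_of_slotsTOfRecord₁₃_succ_ne_zero_of_M₁_le_M)
open BalabanUVNodesN11GaussianCertificateRows
open BalabanUVNodesN11Sect3SupplyChainDefs
open BalabanUVNodesN11Sect3SupplyChainBorelB
open BalabanUVNodesN11Sect3SupplyChainObligationsDefs
open BalabanUVNodesN11Sect3SupplyChainBorelBObligations (borelB_chainWitness_pos_of_supplierBorel)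
open BalabanUVNodesN11AFibreDominationOfCoercive (afibre_rows_adm_of_coercive)
open BalabanUVNodesN11Sect3SupplyChainBorelBObligationsOfSolvable (clause_succ_sameWitness_zero_of_hasSect2FormAtZS_of_zhPin_of_solvable)
open BalabanUVNodesN11NoExpansionTStepZhPinOfBgFact
open BalabanUVNodesN11OneBlockLevels (cover_row_of_nesting_of_powM)

variable {F : T4Family} {N : ℕ} [NeZero N]

/-! ## §1  (γ′) at levels `k ≥ 1` (p605244 layer) without the run guard -/

section SameWitness

variable (θ : Stage13HParams F N) (p : B12.RunParams)

/-- **★★★ (γ′) THE SAME-WITNESS NO-EXPANSION 𝐓-STEP CLAUSE IN THE ZhPin CLASS WITHOUT THE RUN GUARD, GIVEN THE bg FACTS AT `k` AND `k+1`, AT `M = L^a`** — dag-n11-d's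
★★★★★ `clause_succ_sameWitness_of_hasSect2FormAtZS_of_borelB_of_zhPin_of_solvable` (p605244) with `(Provisos₁₃SepCoPH, window at k+1, PartCompat₁₃ at k and k+1)` ↦
`(Provisos₁₃CoPH, hbg, hbg′)` (the CONTENTS of row P11 at `(p,k)` and `(p,k+1)`) and the multi-level cover `hcov` ↦ dag-n11-w4's `cover_row_of_nesting_of_powM` (`L·M₂ ∣ M`,
`M = L^a`); the proof is p605244's with these substitutions (the window at `k` stays — the fibre truncation reads it).  Conclusion VERBATIM.
[cite: Balaban1988Convergent, Theorem p.245, Thm 1 p.262, (2.1)–(2.2) pp.254–255, (2.5) p.255, (2.7) p.255, (2.10) p.256, (2.16)–(2.18) p.257, (2.20)–(2.28) pp.258–259, (2.41)–(2.42) p.261, (3.5) p.265, (3.16) p.268, (3.24)–(3.25) p.270; Balaban1985Variational, Thm 1 (7)–(8) pp.278–279; Balaban1985Averaging, Prop. 2 p.26; Balaban1985RegularSpaces, (1.3)–(1.6) p.77; Balaban1989LargeFieldI, (0.2)–(0.3) p.176] -/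
theorem clause_succ_sameWitness_of_hasSect2FormAtZS_of_borelB_of_zhPin_of_solvable_of_bgFact_of_powM (hζ0 : ∀ (p' : B12.RunParams) (n : ℕ) (Ω Λ : ℕ → Set (Site (F.P p'.K) 0)), (θ.Zh p' n Ω Λ).ζ0 = (ZhPinOfRecord₁₃ θ.toStage13Params p' Ω Λ).ζ0)
    (h : θ.Provisos₁₃CoPH F N) (hθ : θ.Admissible F N)
    (hpos : θ.s2.Pos) (hM₁ : 0 < θ.ν.M₁) (hle : θ.ν.M₁ ≤ θ.τ9.M) {k : ℕ} (hk : k < p.K) (hM : 1 ≤ θ.τ9.M)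
    (hw : Step.InInterval θ.γ k (gOfRecord₁₃ F N θ.toStage13Params p))
    (hbg : BgProvisoΛ F N p.K (settingOfRecord₁₃ F N θ.toStage13Params p) (θ.Rz p.K) θ.τ9.M (k) (suppOfRecord₁₃SepCoP F N θ.toStage13Params p (k))
      (UbgOfRecord₁₃CoP F N θ.toStage13Params p (k)))
    (hbg' : BgProvisoΛ F N p.K (settingOfRecord₁₃ F N θ.toStage13Params p) (θ.Rz p.K) θ.τ9.M (k + 1) (suppOfRecord₁₃SepCoP F N θ.toStage13Params p (k + 1))
      (UbgOfRecord₁₃CoP F N θ.toStage13Params p (k + 1)))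
    (hk1 : 1 ≤ k) (hkm : k + 1 ≤ (F.P p.K).m + (F.P p.K).K) (hcR : 2 ≤ θ.s2.cR)
    (hdiv : (F.P p.K).L * θ.ν.M₂ ∣ θ.τ9.M) {a : ℕ} (hMa : θ.τ9.M = F.L ^ a)
    (h3 : ∀ j, 1 ≤ j → j ≤ k + 1 →
      3 * side (F.P p.K).L θ.ν.M₁ j ≤ cubeSide (F.P p.K).L θ.ν.M₂ (RkOfRecord (F.P p.K).L θ.ν.r (gOfRecord₁₃ F N θ.toStage13Params p j)) j)
    (hR : ∀ j, 1 ≤ j → j ≤ k + 1 → (F.P p.K).L ^ j + (((F.P p.K).d + 4) * (F.P p.K).L + 2) * (∑ l ∈ Finset.range j, (F.P p.K).L ^ l) + 2 ≤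
      cubeSide (F.P p.K).L θ.ν.M₂ (RkOfRecord (F.P p.K).L θ.ν.r (gOfRecord₁₃ F N θ.toStage13Params p j)) j)
    (hε : ∀ j, 1 ≤ j → j ≤ k + 1 → 0 < epsOfRecord θ.ν (gOfRecord₁₃ F N θ.toStage13Params p) j)
    (hε3 : ∀ j, 1 ≤ j → j ≤ k + 1 → (143 * (((((F.P p.K).d + 4 : ℕ) : ℝ)) ^ 2 / 4) ^ 2) * epsOfRecord θ.ν (gOfRecord₁₃ F N θ.toStage13Params p) j ≤ 1 / 3)
    (hε2 : ∀ j, 1 ≤ j → j ≤ k + 1 →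
      2 * epsOfRecord θ.ν (gOfRecord₁₃ F N θ.toStage13Params p) j ≤ 2 * ExpMeanLog.deltaSU (Fin N) / ((((F.P p.K).d + 4) * (F.P p.K).L : ℕ) : ℝ) ^ 2)
    (hsolv : ∀ j, 1 ≤ j → j ≤ k + 1 → ∀ (s : SeqOfRecord F θ.ν θ.τ9.M (gOfRecord₁₃ F N θ.toStage13Params p) p.K j) (V : GaugeField (F.P p.K) j (SU N)),
      chiSeqOfRecord F N θ.ν θ.τ9.M (gOfRecord₁₃ F N θ.toStage13Params p) p.K j s V ≠ 0 →
      ∀ a ∈ cubesIn (fun a : ↥(cubeIndices (F.P p.K) (cubeSide (F.P p.K).L θ.ν.M₂ (RkOfRecord (F.P p.K).L θ.ν.r (gOfRecord₁₃ F N θ.toStage13Params p j)) j)) =>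
          cubeEnl (F.P p.K) (cubeSide (F.P p.K).L θ.ν.M₂ (RkOfRecord (F.P p.K).L θ.ν.r (gOfRecord₁₃ F N θ.toStage13Params p j)) j) a 0) (s.Ω j),
        ∃ U₀, IsMinimizer (avOfRecord F N p.K) {U | PlaqSmall (θ.ν.εreg * (F.P p.K).eta j ^ 2) U}
          (Bj θ.ν.M₁ (cubeEnl (F.P p.K) (cubeSide (F.P p.K).L θ.ν.M₂ (RkOfRecord (F.P p.K).L θ.ν.r (gOfRecord₁₃ F N θ.toStage13Params p j)) j) a 4) j)
          (avgFamily (avOfRecord F N p.K) (qsstarGIter0 j V)) U₀)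
    (t₀ : SeqOfRecord F θ.ν θ.τ9.M (gOfRecord₁₃ F N θ.toStage13Params p) p.K k → Sect2.TermValues (F.P p.K) (MatA N) (FluctV N) θ.τ9.M)
    (E₀ : SeqOfRecord F θ.ν θ.τ9.M (gOfRecord₁₃ F N θ.toStage13Params p) p.K k → ℝ)
    (hform₀ : HasSect2FormAtZS F N (FluctV N) p.K (settingOfRecord₁₃ F N θ.toStage13Params p) k (θ.rzAt p) (WtOfRecord₁₃H F N θ p)
      (UbgOfRecord₁₃CoP F N θ.toStage13Params p k)
      (fun s₀ t' => Sect2.LawsRT (sect2TowerOfRecord F N (FluctV N) p.K (settingOfRecord₁₃ F N θ.toStage13Params p) (θ.rzAt p s₀) s₀ t')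
        (settingOfRecord₁₃ F N θ.toStage13Params p).lf k)
      (slotsOfRecord F N θ.ν θ.τ9 (EOfRecord₁₃ F N θ.toStage13Params) (wOfRecord₉ F N θ.toStage9Params) θ.ppSel p (gOfRecord₁₃ F N θ.toStage13Params p) k) t₀ E₀)
    (hBt : ∀ s₀ (S' : ℕ → Set (Site (F.P p.K) 0)) (j : ℕ) (X : (Sect2.domSys (F.P p.K) θ.τ9.M j).Dom), 1 ≤ j → j ≤ k →
      Measurable (fun q : GaugeField (F.P p.K) 0 (SU N) × MSFluct (F.P p.K) (FluctV N) =>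
        (t₀ s₀).B j X (Sect2.ofBackgroundC (settingOfRecord₁₃ F N θ.toStage13Params p).ι q.1) (S', q.2)))
    :
    ∀ (s : SeqOfRecord F θ.ν θ.τ9.M (gOfRecord₁₃ F N θ.toStage13Params p) p.K (k + 1)), s.Ω (k + 1) = ∅ →
        -- (P) prefix agreement below `k`
        (∀ j, j < k → (θ.zhAt p s).ζ0 j = (θ.zhAt p s.init).ζ0 j ∧ (θ.zhAt p s).quad j = (θ.zhAt p s.init).quad j) →
        -- (V) the generation-`k` pin with the old front factor
        (∀ (V' : GaugeField (F.P p.K) (k + 1) (SU N)) (U₀ : GaugeField (F.P p.K) k (SU N)),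
          (θ.zhAt p s).ζ0 k Set.univ (pairCfgAt (V := FluctV N) k V' U₀) =
            chiSeqOfRecord F N θ.ν θ.τ9.M (gOfRecord₁₃ F N θ.toStage13Params p) p.K k s.init U₀ *
              wOfRecord₉ F N θ.toStage9Params p (gOfRecord₁₃ F N θ.toStage13Params p) k s U₀ ((avOfRecord F N p.K k).avg U₀)) →
        -- `quad_k(∅) = 0` on the two-scale configurations
        (∀ (V' : GaugeField (F.P p.K) (k + 1) (SU N)) (U₀ : GaugeField (F.P p.K) k (SU N)), (θ.zhAt p s).quad k ∅ (pairCfgAt (V := FluctV N) k V' U₀) = 0) →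
        -- `k`-locality of `quad_j(Λ_{j+1})`, `j < k`
        (∀ j, j < k → ∀ ω ω' : MultiCfg (F.P p.K) (SU N) (FluctV N), (∀ i, i ≤ k → ω i = ω' i) →
          (θ.zhAt p s).quad j (s.init.Λ (j + 1)) ω = (θ.zhAt p s).quad j (s.init.Λ (j + 1)) ω') →
        -- measurability of the residual serving `s′`
        (∀ j (Y : Set (Site (F.P p.K) 0)), Measurable ((θ.zhAt p s).ζ0 j Y)) →
        (∀ j (Λ' : Set (Site (F.P p.K) 0)), Measurable ((θ.zhAt p s).quad j Λ')) →
        -- per old branch: A-fibre domination (K0b)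
        (∀ S ∈ admSOfRecord F θ.ν θ.τ9.M (gOfRecord₁₃ F N θ.toStage13Params p) p.K k s.init, ∀ j : ℕ,
          ∃ ŵ : (↥(Set.toFinite (B10Eq42TorusConstraint.bondsIn j ((s.init.Λ (j + 1))ᶜ ∩ s.init.Ω (j + 1)))).toFinset → FluctV N) → ℝ≥0∞, Measurable ŵ ∧
            (∫⁻ a, ŵ a ∂(Measure.pi fun _ : ↥(Set.toFinite (B10Eq42TorusConstraint.bondsIn j ((s.init.Λ (j + 1))ᶜ ∩ s.init.Ω (j + 1)))).toFinset => (volume : Measure (FluctV N)))) ≠ ⊤ ∧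
            ∀ ω, ENNReal.ofReal ((WtOfRecord₁₃H F N θ p s).w j (s.init.Λ (j + 1)) ((s.init.Λ (j + 1))ᶜ ∩ s.init.Ω (j + 1)) (S (j + 1)) ω) ≤
              ŵ (fun b : ↥(Set.toFinite (B10Eq42TorusConstraint.bondsIn j ((s.init.Λ (j + 1))ᶜ ∩ s.init.Ω (j + 1)))).toFinset => (ω j).2 b)) →
        (slotsTOfRecord F N θ.ν θ.τ9 (EOfRecord₁₃ F N θ.toStage13Params) (wOfRecord₉ F N θ.toStage9Params) θ.ppSel p
            (gOfRecord₁₃ F N θ.toStage13Params p) (k + 1) s = 0 ∨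
          ∀ᵐ V' ∂fieldMeasure (F.P p.K) (k + 1) (SU N),
            chiSeqOfRecord F N θ.ν θ.τ9.M (gOfRecord₁₃ F N θ.toStage13Params p) p.K (k + 1) s V' ≠ 0 →
              slotsTOfRecord F N θ.ν θ.τ9 (EOfRecord₁₃ F N θ.toStage13Params) (wOfRecord₉ F N θ.toStage9Params) θ.ppSel p
                  (gOfRecord₁₃ F N θ.toStage13Params p) (k + 1) s V' =
                sect2Slot F N (FluctV N) p.K (settingOfRecord₁₃ F N θ.toStage13Params p) (θ.rzAt p s) (WtOfRecord₁₃H F N θ p s) s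
                  (t₀ s.init) (E₀ s.init) (UbgOfRecord₁₃CoP F N θ.toStage13Params p (k + 1) s) V') := by
  -- the rows restricted to the parent levels `≤ k`
  have hkm₀ : k ≤ (F.P p.K).m + (F.P p.K).K := (Nat.le_succ k).trans hkm
  refine clause_succ_sameWitness_of_hasSect2FormAtZS_of_borelB_of_bgReadChargedFibre θ p h (zhUnity_of_gaussCert θ hζ0) hθ hpos hk hM hw θ.s2.cR
    (fun s₀ j Y => {x | (j < k ∧ Y = (s₀.Ω (j + 1))ᶜ) ∧ x ∈ readSelOfSeq F p (suppDomOfRecord F θ.ν p.K s₀.Ω) s₀.Ω j Y})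
    (fun s₀ => regOn_cutSel_of_zhPin_of_solvable θ p hζ0 hk.le hkm₀ hcR hM₁ (fun j h1 hj => h3 j h1 (Nat.le_succ_of_le hj))
      (fun j h1 hj => hR j h1 (Nat.le_succ_of_le hj)) (fun j h1 hj => hε j h1 (Nat.le_succ_of_le hj)) (fun j h1 hj => hε3 j h1 (Nat.le_succ_of_le hj))
      (fun j h1 hj => hε2 j h1 (Nat.le_succ_of_le hj)) (fun j h1 hj => hsolv j h1 (Nat.le_succ_of_le hj)) (fun j h1 hj => (cover_row_of_nesting_of_powM θ p hdiv hMa) j h1 (Nat.le_succ_of_le hj)) s₀)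
    (bgProvisoΛ_chargedFibre_of_sep_of_junctionFibre θ p hM₁ hle θ.s2.cR (fun s₀ j Y => {x | (j < k ∧ Y = (s₀.Ω (j + 1))ᶜ) ∧ x ∈ readSelOfSeq F p (suppDomOfRecord F θ.ν p.K s₀.Ω) s₀.Ω j Y}) hbg
      fun s₀ hch hs Wc hχ hlow => sepJunctionChargedFibre_of_solvable θ p hk1 hkm₀ hcR hM₁ (h3 k hk1 (Nat.le_succ k)) (hR k hk1 (Nat.le_succ k))
        (hε k hk1 (Nat.le_succ k)) (hε3 k hk1 (Nat.le_succ k)) (hε2 k hk1 (Nat.le_succ k))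
        (fun s₁ _ _ Wc₁ hχ₁ => hsolv k hk1 (Nat.le_succ k) s₁ (Wc₁ k) hχ₁) (fun s₁ => (cover_row_of_nesting_of_powM θ p hdiv hMa) k hk1 (Nat.le_succ k) s₁) s₀ hch hs Wc hχ
        fun j hj => by have h' := hlow j hj; beta_reduce at h'; rw [sep_setOf_eq_of (And.intro hj rfl)] at h'; exact h')
    t₀ E₀ hform₀ hBt
    (fun s₀ j Y => {x | (j < k + 1 ∧ Y = (s₀.Ω (j + 1))ᶜ) ∧ x ∈ readSelOfSeq F p (suppDomOfRecord F θ.ν p.K s₀.Ω) s₀.Ω j Y})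
    (fun s => regOn_cutSel_of_zhPin_of_solvable θ p hζ0 hk hkm hcR hM₁ h3 hR hε hε3 hε2 hsolv (cover_row_of_nesting_of_powM θ p hdiv hMa) s)
    fun s Wc hWc j h1 hj X => ?_
  -- the child-level proviso: the displayed bg FACT at level `k+1` + the charge-free fibre junction at level `k+1` (T-charged child ⇒ separated)
  have hs : Sect2.SeqSeparated θ.ν.M₁ s := seqSeparated_of_slotsTOfRecord₁₃_succ_ne_zero_of_M₁_le_M θ p hM₁ hle s hWc.1
  refine hbg' s Wc ?_ j h1 (Nat.le_succ_of_le hj) X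
  refine mem_suppOfRecord₁₃SepCoP_of_sep_of_top_of_fibre θ p (Nat.succ_pos k) hM₁ s hs Wc
    (fun j' hj' => by have h' := hWc.2.2.1 j' hj'; beta_reduce at h'; rw [sep_setOf_eq_of (And.intro hj' rfl)] at h'; exact h') ?_ hWc.2.2.2.2
  have h2 := plaqSmallOn_genSet_top_of_chiSeqOfRecord_ne_zero_of_solvable (F := F) (N := N) θ.ν θ.τ9.M (gOfRecord₁₃ F N θ.toStage13Params p) p.K (k + 1)
    hkm s (Wc (k + 1)) hWc.2.1 hM₁ (h3 (k + 1) (Nat.succ_pos k) le_rfl) (hR (k + 1) (Nat.succ_pos k) le_rfl) (hε (k + 1) (Nat.succ_pos k) le_rfl)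
    (hε3 (k + 1) (Nat.succ_pos k) le_rfl) (hε2 (k + 1) (Nat.succ_pos k) le_rfl) (hsolv (k + 1) (Nat.succ_pos k) le_rfl s (Wc (k + 1)) hWc.2.1)
    ((cover_row_of_nesting_of_powM θ p hdiv hMa) (k + 1) (Nat.succ_pos k) le_rfl s)
  exact fun q hq => (h2 q hq).trans_le (mul_le_mul_of_nonneg_right hcR (hε (k + 1) (Nat.succ_pos k) le_rfl).le)

end SameWitness

/-! ## §2  (γ′) at every level `k < K` without the run guard (this seat's A §2 re-keyed) -/

section All

variable (θ : Stage13HParams F N) (p : B12.RunParams)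

/-- **★★★ (γ′) AT EVERY LEVEL `k < K` WITHOUT THE RUN GUARD** — this seat's A §2 glue (p607459) re-keyed: level `0` by A §1 (no bg fact, no guard there: `BgProvisoΛ … 0 …`
quantifies `1 ≤ j ≤ 0`), levels `≥ 1` by §1; rows: core provisos, admissibility, `s2.Pos`, `0 < M₁ ≤ M`, `1 ≤ M`, the window at `k`, the bg FACTS at `k` and `k+1`, `2 ≤ cR`,
`L·M₂ ∣ M`, `M = L^a`, per level `1 ≤ j ≤ k+1` the numerics and K0's per-cube [15]-solvability; the named witness with Borel 𝐁-terms on `[1,k]`.  Conclusion VERBATIM.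
[cite: Balaban1988Convergent, Theorem p.245, Thm 1 p.262, (2.1)–(2.2) pp.254–255, (2.10) p.256, (2.16)–(2.18) p.257, (2.20)–(2.28) pp.258–259, (3.5) p.265, (3.16) p.268, (3.24)–(3.25) p.270; Balaban1985Variational, Thm 1 (7)–(8) pp.278–279; Balaban1989LargeFieldI, (0.2)–(0.3) p.176] -/
theorem clause_succ_sameWitness_of_hasSect2FormAtZS_of_borelB_of_zhPin_of_solvable_all_of_bgFact_of_powM
    (hζ0 : ∀ (p' : B12.RunParams) (n : ℕ) (Ω Λ : ℕ → Set (Site (F.P p'.K) 0)), (θ.Zh p' n Ω Λ).ζ0 = (ZhPinOfRecord₁₃ θ.toStage13Params p' Ω Λ).ζ0)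
    (h : θ.Provisos₁₃CoPH F N) (hθ : θ.Admissible F N)
    (hpos : θ.s2.Pos) (hM₁ : 0 < θ.ν.M₁) (hle : θ.ν.M₁ ≤ θ.τ9.M) {k : ℕ} (hk : k < p.K) (hM : 1 ≤ θ.τ9.M)
    (hw : Step.InInterval θ.γ k (gOfRecord₁₃ F N θ.toStage13Params p))
    (hbg : BgProvisoΛ F N p.K (settingOfRecord₁₃ F N θ.toStage13Params p) (θ.Rz p.K) θ.τ9.M (k) (suppOfRecord₁₃SepCoP F N θ.toStage13Params p (k))
      (UbgOfRecord₁₃CoP F N θ.toStage13Params p (k)))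
    (hbg' : BgProvisoΛ F N p.K (settingOfRecord₁₃ F N θ.toStage13Params p) (θ.Rz p.K) θ.τ9.M (k + 1) (suppOfRecord₁₃SepCoP F N θ.toStage13Params p (k + 1))
      (UbgOfRecord₁₃CoP F N θ.toStage13Params p (k + 1))) (hcR : 2 ≤ θ.s2.cR)
    (hdiv : (F.P p.K).L * θ.ν.M₂ ∣ θ.τ9.M) {a : ℕ} (hMa : θ.τ9.M = F.L ^ a)
    (h3 : ∀ j, 1 ≤ j → j ≤ k + 1 →
      3 * side (F.P p.K).L θ.ν.M₁ j ≤ cubeSide (F.P p.K).L θ.ν.M₂ (RkOfRecord (F.P p.K).L θ.ν.r (gOfRecord₁₃ F N θ.toStage13Params p j)) j)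
    (hR : ∀ j, 1 ≤ j → j ≤ k + 1 → (F.P p.K).L ^ j + (((F.P p.K).d + 4) * (F.P p.K).L + 2) * (∑ l ∈ Finset.range j, (F.P p.K).L ^ l) + 2 ≤
      cubeSide (F.P p.K).L θ.ν.M₂ (RkOfRecord (F.P p.K).L θ.ν.r (gOfRecord₁₃ F N θ.toStage13Params p j)) j)
    (hε : ∀ j, 1 ≤ j → j ≤ k + 1 → 0 < epsOfRecord θ.ν (gOfRecord₁₃ F N θ.toStage13Params p) j)
    (hε3 : ∀ j, 1 ≤ j → j ≤ k + 1 → (143 * (((((F.P p.K).d + 4 : ℕ) : ℝ)) ^ 2 / 4) ^ 2) * epsOfRecord θ.ν (gOfRecord₁₃ F N θ.toStage13Params p) j ≤ 1 / 3)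
    (hε2 : ∀ j, 1 ≤ j → j ≤ k + 1 →
      2 * epsOfRecord θ.ν (gOfRecord₁₃ F N θ.toStage13Params p) j ≤ 2 * ExpMeanLog.deltaSU (Fin N) / ((((F.P p.K).d + 4) * (F.P p.K).L : ℕ) : ℝ) ^ 2)
    (hsolv : ∀ j, 1 ≤ j → j ≤ k + 1 → ∀ (s : SeqOfRecord F θ.ν θ.τ9.M (gOfRecord₁₃ F N θ.toStage13Params p) p.K j) (V : GaugeField (F.P p.K) j (SU N)),
      chiSeqOfRecord F N θ.ν θ.τ9.M (gOfRecord₁₃ F N θ.toStage13Params p) p.K j s V ≠ 0 →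
      ∀ a ∈ cubesIn (fun a : ↥(cubeIndices (F.P p.K) (cubeSide (F.P p.K).L θ.ν.M₂ (RkOfRecord (F.P p.K).L θ.ν.r (gOfRecord₁₃ F N θ.toStage13Params p j)) j)) =>
          cubeEnl (F.P p.K) (cubeSide (F.P p.K).L θ.ν.M₂ (RkOfRecord (F.P p.K).L θ.ν.r (gOfRecord₁₃ F N θ.toStage13Params p j)) j) a 0) (s.Ω j),
        ∃ U₀, IsMinimizer (avOfRecord F N p.K) {U | PlaqSmall (θ.ν.εreg * (F.P p.K).eta j ^ 2) U}
          (Bj θ.ν.M₁ (cubeEnl (F.P p.K) (cubeSide (F.P p.K).L θ.ν.M₂ (RkOfRecord (F.P p.K).L θ.ν.r (gOfRecord₁₃ F N θ.toStage13Params p j)) j) a 4) j)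
          (avgFamily (avOfRecord F N p.K) (qsstarGIter0 j V)) U₀)
    (t₀ : SeqOfRecord F θ.ν θ.τ9.M (gOfRecord₁₃ F N θ.toStage13Params p) p.K k → Sect2.TermValues (F.P p.K) (MatA N) (FluctV N) θ.τ9.M)
    (E₀ : SeqOfRecord F θ.ν θ.τ9.M (gOfRecord₁₃ F N θ.toStage13Params p) p.K k → ℝ)
    (hform₀ : HasSect2FormAtZS F N (FluctV N) p.K (settingOfRecord₁₃ F N θ.toStage13Params p) k (θ.rzAt p) (WtOfRecord₁₃H F N θ p)
      (UbgOfRecord₁₃CoP F N θ.toStage13Params p k)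
      (fun s₀ t' => Sect2.LawsRT (sect2TowerOfRecord F N (FluctV N) p.K (settingOfRecord₁₃ F N θ.toStage13Params p) (θ.rzAt p s₀) s₀ t')
        (settingOfRecord₁₃ F N θ.toStage13Params p).lf k)
      (slotsOfRecord F N θ.ν θ.τ9 (EOfRecord₁₃ F N θ.toStage13Params) (wOfRecord₉ F N θ.toStage9Params) θ.ppSel p (gOfRecord₁₃ F N θ.toStage13Params p) k) t₀ E₀)
    (hBt : ∀ s₀ (S' : ℕ → Set (Site (F.P p.K) 0)) (j : ℕ) (X : (Sect2.domSys (F.P p.K) θ.τ9.M j).Dom), 1 ≤ j → j ≤ k →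
      Measurable (fun q : GaugeField (F.P p.K) 0 (SU N) × MSFluct (F.P p.K) (FluctV N) =>
        (t₀ s₀).B j X (Sect2.ofBackgroundC (settingOfRecord₁₃ F N θ.toStage13Params p).ι q.1) (S', q.2))) :
    ∀ (s : SeqOfRecord F θ.ν θ.τ9.M (gOfRecord₁₃ F N θ.toStage13Params p) p.K (k + 1)), s.Ω (k + 1) = ∅ →
        (∀ j, j < k → (θ.zhAt p s).ζ0 j = (θ.zhAt p s.init).ζ0 j ∧ (θ.zhAt p s).quad j = (θ.zhAt p s.init).quad j) →
        (∀ (V' : GaugeField (F.P p.K) (k + 1) (SU N)) (U₀ : GaugeField (F.P p.K) k (SU N)),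
          (θ.zhAt p s).ζ0 k Set.univ (pairCfgAt (V := FluctV N) k V' U₀) =
            chiSeqOfRecord F N θ.ν θ.τ9.M (gOfRecord₁₃ F N θ.toStage13Params p) p.K k s.init U₀ *
              wOfRecord₉ F N θ.toStage9Params p (gOfRecord₁₃ F N θ.toStage13Params p) k s U₀ ((avOfRecord F N p.K k).avg U₀)) →
        (∀ (V' : GaugeField (F.P p.K) (k + 1) (SU N)) (U₀ : GaugeField (F.P p.K) k (SU N)), (θ.zhAt p s).quad k ∅ (pairCfgAt (V := FluctV N) k V' U₀) = 0) →
        (∀ j, j < k → ∀ ω ω' : MultiCfg (F.P p.K) (SU N) (FluctV N), (∀ i, i ≤ k → ω i = ω' i) →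
          (θ.zhAt p s).quad j (s.init.Λ (j + 1)) ω = (θ.zhAt p s).quad j (s.init.Λ (j + 1)) ω') →
        (∀ j (Y : Set (Site (F.P p.K) 0)), Measurable ((θ.zhAt p s).ζ0 j Y)) →
        (∀ j (Λ' : Set (Site (F.P p.K) 0)), Measurable ((θ.zhAt p s).quad j Λ')) →
        (∀ S ∈ admSOfRecord F θ.ν θ.τ9.M (gOfRecord₁₃ F N θ.toStage13Params p) p.K k s.init, ∀ j : ℕ,
          ∃ ŵ : (↥(Set.toFinite (B10Eq42TorusConstraint.bondsIn j ((s.init.Λ (j + 1))ᶜ ∩ s.init.Ω (j + 1)))).toFinset → FluctV N) → ℝ≥0∞, Measurable ŵ ∧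
            (∫⁻ a, ŵ a ∂(Measure.pi fun _ : ↥(Set.toFinite (B10Eq42TorusConstraint.bondsIn j ((s.init.Λ (j + 1))ᶜ ∩ s.init.Ω (j + 1)))).toFinset => (volume : Measure (FluctV N)))) ≠ ⊤ ∧
            ∀ ω, ENNReal.ofReal ((WtOfRecord₁₃H F N θ p s).w j (s.init.Λ (j + 1)) ((s.init.Λ (j + 1))ᶜ ∩ s.init.Ω (j + 1)) (S (j + 1)) ω) ≤
              ŵ (fun b : ↥(Set.toFinite (B10Eq42TorusConstraint.bondsIn j ((s.init.Λ (j + 1))ᶜ ∩ s.init.Ω (j + 1)))).toFinset => (ω j).2 b)) →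
        (slotsTOfRecord F N θ.ν θ.τ9 (EOfRecord₁₃ F N θ.toStage13Params) (wOfRecord₉ F N θ.toStage9Params) θ.ppSel p
            (gOfRecord₁₃ F N θ.toStage13Params p) (k + 1) s = 0 ∨
          ∀ᵐ V' ∂fieldMeasure (F.P p.K) (k + 1) (SU N),
            chiSeqOfRecord F N θ.ν θ.τ9.M (gOfRecord₁₃ F N θ.toStage13Params p) p.K (k + 1) s V' ≠ 0 →
              slotsTOfRecord F N θ.ν θ.τ9 (EOfRecord₁₃ F N θ.toStage13Params) (wOfRecord₉ F N θ.toStage9Params) θ.ppSel p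
                  (gOfRecord₁₃ F N θ.toStage13Params p) (k + 1) s V' =
                sect2Slot F N (FluctV N) p.K (settingOfRecord₁₃ F N θ.toStage13Params p) (θ.rzAt p s) (WtOfRecord₁₃H F N θ p s) s
                  (t₀ s.init) (E₀ s.init) (UbgOfRecord₁₃CoP F N θ.toStage13Params p (k + 1) s) V') := by
  cases k with
  | zero =>
    exact clause_succ_sameWitness_zero_of_hasSect2FormAtZS_of_zhPin_of_solvable θ p hζ0 h hθ hpos hM₁ hk hM hw hcR (h3 1 le_rfl le_rfl)
      (hR 1 le_rfl le_rfl) (hε 1 le_rfl le_rfl) (hε3 1 le_rfl le_rfl) (hε2 1 le_rfl le_rfl) (hsolv 1 le_rfl le_rfl)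
      (cover_row_of_nesting_of_powM θ p hdiv hMa (k := 1) 1 le_rfl le_rfl) t₀ E₀ hform₀
  | succ k =>
    have hkm : k + 1 + 1 ≤ (F.P p.K).m + (F.P p.K).K := (Nat.succ_le_of_lt hk).trans (Nat.le_add_left _ _)
    exact clause_succ_sameWitness_of_hasSect2FormAtZS_of_borelB_of_zhPin_of_solvable_of_bgFact_of_powM θ p hζ0 h hθ hpos hM₁ hle hk hM hw hbg hbg'
      (Nat.succ_pos k) hkm hcR hdiv hMa h3 hR hε hε3 hε2 hsolv t₀ E₀ hform₀ hBt

end All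

/-! ## §3  The BorelB road's no-expansion half and N11's token without the run guard, given the bg facts of the run -/

section Obligation

variable (θ : Stage13HParams F N) (p : B12.RunParams)

/-- **★★★★ `NoExpansionObligation θ p σ` AT ANY `θ` OF THE GAUSSIAN-CERTIFICATE CLASS WITHOUT THE RUN GUARD, GIVEN THE bg FACTS OF THE RUN, AT `M = L^a`** — this seat's
A §3 (p607459) with `(Provisos₁₃SepCoPH, PartCompat₁₃ up to K, the cube cover)` ↦ `(Provisos₁₃CoPH, hbgs : ∀ k ≤ K, BgProvisoΛ … k …, L·M₂ ∣ M, M = L^a)`: the BorelB road's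
no-expansion half now reads the record's background-regularity CONTENT per level instead of the guarded row, and NO `PartCompat₁₃` at all (dag-n11-w4 g4: «below the floor what
stays guarded is K0's row bg» — here the road is typed for WHOEVER supplies that content, guarded row on compatible runs or a future one-block [15] supplier).  Displayed besides:
the certificate, admissibility, `0 < M₁ ≤ M`, `2 ≤ cR`, the window up to `K`, the five numeric rows and K0's per-cube [15]-solvability at levels `1…K`, `SupplierBorel`.
[cite: Balaban1988Convergent, Theorem p.245, Thm 1 p.262, §3 p.279, (3.24)–(3.25) p.270, (2.5) p.255, (2.10) p.256, (2.16)–(2.18) p.257, (2.27)–(2.28) p.259, p.257; Balaban1985Variational, Thm 1 (7)–(8) pp.278–279] -/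
theorem noExpansionObligation_of_gaussCert_of_supplierBorel_of_bgFacts_of_powM
    (hζ : ∀ (p' : B12.RunParams) (n : ℕ) (Ω Λ : ℕ → Set (Site (F.P p'.K) 0)), (θ.Zh p' n Ω Λ).ζ0 = (ZhPinOfRecord₁₃ θ.toStage13Params p' Ω Λ).ζ0)
    (hq : ∀ (p' : B12.RunParams) (n : ℕ) (Ω Λ : ℕ → Set (Site (F.P p'.K) 0)) (j : ℕ) (Λ' : Set (Site (F.P p'.K) 0)) (ω : MultiCfg (F.P p'.K) (SU N) (FluctV N)),
      (θ.Zh p' n Ω Λ).quad j Λ' ω = ∑ b ∈ (Set.toFinite (bondsIn j (Λ'ᶜ ∩ Ω (j + 1)))).toFinset, ‖(ω j).2 b‖ ^ 2)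
    (h : θ.Provisos₁₃CoPH F N) (hθ : θ.Admissible F N) (hM₁ : 0 < θ.ν.M₁) (hle : θ.ν.M₁ ≤ θ.τ9.M) (hcR : 2 ≤ θ.s2.cR)
    (hw : Step.InInterval θ.γ p.K (gOfRecord₁₃ F N θ.toStage13Params p))
    (hbgs : ∀ k, k ≤ p.K → BgProvisoΛ F N p.K (settingOfRecord₁₃ F N θ.toStage13Params p) (θ.Rz p.K) θ.τ9.M k (suppOfRecord₁₃SepCoP F N θ.toStage13Params p k)
      (UbgOfRecord₁₃CoP F N θ.toStage13Params p k))
    (hdiv : (F.P p.K).L * θ.ν.M₂ ∣ θ.τ9.M) {a : ℕ} (hMa : θ.τ9.M = F.L ^ a)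
    (h3 : ∀ j, 1 ≤ j → j ≤ p.K →
      3 * side (F.P p.K).L θ.ν.M₁ j ≤ cubeSide (F.P p.K).L θ.ν.M₂ (RkOfRecord (F.P p.K).L θ.ν.r (gOfRecord₁₃ F N θ.toStage13Params p j)) j)
    (hR : ∀ j, 1 ≤ j → j ≤ p.K → (F.P p.K).L ^ j + (((F.P p.K).d + 4) * (F.P p.K).L + 2) * (∑ l ∈ Finset.range j, (F.P p.K).L ^ l) + 2 ≤
      cubeSide (F.P p.K).L θ.ν.M₂ (RkOfRecord (F.P p.K).L θ.ν.r (gOfRecord₁₃ F N θ.toStage13Params p j)) j)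
    (hε : ∀ j, 1 ≤ j → j ≤ p.K → 0 < epsOfRecord θ.ν (gOfRecord₁₃ F N θ.toStage13Params p) j)
    (hε3 : ∀ j, 1 ≤ j → j ≤ p.K → (143 * (((((F.P p.K).d + 4 : ℕ) : ℝ)) ^ 2 / 4) ^ 2) * epsOfRecord θ.ν (gOfRecord₁₃ F N θ.toStage13Params p) j ≤ 1 / 3)
    (hε2 : ∀ j, 1 ≤ j → j ≤ p.K →
      2 * epsOfRecord θ.ν (gOfRecord₁₃ F N θ.toStage13Params p) j ≤ 2 * ExpMeanLog.deltaSU (Fin N) / ((((F.P p.K).d + 4) * (F.P p.K).L : ℕ) : ℝ) ^ 2)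
    (hsolv : ∀ j, 1 ≤ j → j ≤ p.K → ∀ (s : SeqOfRecord F θ.ν θ.τ9.M (gOfRecord₁₃ F N θ.toStage13Params p) p.K j) (V : GaugeField (F.P p.K) j (SU N)),
      chiSeqOfRecord F N θ.ν θ.τ9.M (gOfRecord₁₃ F N θ.toStage13Params p) p.K j s V ≠ 0 →
      ∀ a ∈ cubesIn (fun a : ↥(cubeIndices (F.P p.K) (cubeSide (F.P p.K).L θ.ν.M₂ (RkOfRecord (F.P p.K).L θ.ν.r (gOfRecord₁₃ F N θ.toStage13Params p j)) j)) =>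
          cubeEnl (F.P p.K) (cubeSide (F.P p.K).L θ.ν.M₂ (RkOfRecord (F.P p.K).L θ.ν.r (gOfRecord₁₃ F N θ.toStage13Params p j)) j) a 0) (s.Ω j),
        ∃ U₀, IsMinimizer (avOfRecord F N p.K) {U | PlaqSmall (θ.ν.εreg * (F.P p.K).eta j ^ 2) U}
          (Bj θ.ν.M₁ (cubeEnl (F.P p.K) (cubeSide (F.P p.K).L θ.ν.M₂ (RkOfRecord (F.P p.K).L θ.ν.r (gOfRecord₁₃ F N θ.toStage13Params p j)) j) a 4) j)
          (avgFamily (avOfRecord F N p.K) (qsstarGIter0 j V)) U₀)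
    (σ : Sect3Supplier θ p) (hσB : SupplierBorel θ p σ) :
    NoExpansionObligation θ p σ := fun k hk hform s hΩ =>
  clause_succ_sameWitness_of_hasSect2FormAtZS_of_borelB_of_zhPin_of_solvable_all_of_bgFact_of_powM θ p hζ h hθ hθ.toStage12.pos hM₁ hle hk ((Nat.succ_le_of_lt hM₁).trans hle)
    (fun j hj => hw j (hj.trans hk.le)) (hbgs k hk.le) (hbgs (k + 1) hk) hcR hdiv hMa (fun j h1 hj => h3 j h1 (hj.trans hk)) (fun j h1 hj => hR j h1 (hj.trans hk)) (fun j h1 hj => hε j h1 (hj.trans hk))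
    (fun j h1 hj => hε3 j h1 (hj.trans hk)) (fun j h1 hj => hε2 j h1 (hj.trans hk)) (fun j h1 hj => hsolv j h1 (hj.trans hk))
    (chainWitness θ p σ k).1 (chainWitness θ p σ k).2 ((chainFormAt_iff σ k).1 hform)
    (fun s₀ S' j X h1 hj => borelB_chainWitness_pos_of_supplierBorel σ hσB k s₀ S' j X h1 hj) s hΩ
    (prefix_agree_of_gaussCert θ p hζ hq s hΩ) (ζ0_pin_of_gaussCert θ p hζ hk s hΩ) (quad_empty_pairCfgAt_of_gaussCert θ p hq s)
    (quad_local_of_gaussCert θ p hq s) (fun j Y => measurable_ζ0_of_gaussCert θ p hζ h s j Y) (fun j Λ' => measurable_quad_of_gaussCert θ p hq s j Λ')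
    (afibre_rows_adm_of_coercive θ p s fun j => coercive_of_gaussCert θ p hq s j)

/-- **★★★★ N11's ONE-TOKEN RESIDUAL `SupplyChainAt θ p` AT A GAUSSIAN CERTIFICATE WITHOUT THE RUN GUARD, GIVEN THE bg FACTS OF THE RUN, AT `M = L^a`** (from a supplier with
`SupplierObligations` + `SupplierBorel`). [cite: Balaban1988Convergent, Thm 1 p.262, Theorem p.245, §3 p.279, (3.24)–(3.25) p.270, (2.28) p.259, p.257] -/
theorem supplyChainAt_of_gaussCert_of_supplierBorel_of_bgFacts_of_powM
    (hζ : ∀ (p' : B12.RunParams) (n : ℕ) (Ω Λ : ℕ → Set (Site (F.P p'.K) 0)), (θ.Zh p' n Ω Λ).ζ0 = (ZhPinOfRecord₁₃ θ.toStage13Params p' Ω Λ).ζ0)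
    (hq : ∀ (p' : B12.RunParams) (n : ℕ) (Ω Λ : ℕ → Set (Site (F.P p'.K) 0)) (j : ℕ) (Λ' : Set (Site (F.P p'.K) 0)) (ω : MultiCfg (F.P p'.K) (SU N) (FluctV N)),
      (θ.Zh p' n Ω Λ).quad j Λ' ω = ∑ b ∈ (Set.toFinite (bondsIn j (Λ'ᶜ ∩ Ω (j + 1)))).toFinset, ‖(ω j).2 b‖ ^ 2)
    (h : θ.Provisos₁₃CoPH F N) (hθ : θ.Admissible F N) (hM₁ : 0 < θ.ν.M₁) (hle : θ.ν.M₁ ≤ θ.τ9.M) (hcR : 2 ≤ θ.s2.cR)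
    (hw : Step.InInterval θ.γ p.K (gOfRecord₁₃ F N θ.toStage13Params p))
    (hbgs : ∀ k, k ≤ p.K → BgProvisoΛ F N p.K (settingOfRecord₁₃ F N θ.toStage13Params p) (θ.Rz p.K) θ.τ9.M k (suppOfRecord₁₃SepCoP F N θ.toStage13Params p k)
      (UbgOfRecord₁₃CoP F N θ.toStage13Params p k))
    (hdiv : (F.P p.K).L * θ.ν.M₂ ∣ θ.τ9.M) {a : ℕ} (hMa : θ.τ9.M = F.L ^ a)
    (h3 : ∀ j, 1 ≤ j → j ≤ p.K →
      3 * side (F.P p.K).L θ.ν.M₁ j ≤ cubeSide (F.P p.K).L θ.ν.M₂ (RkOfRecord (F.P p.K).L θ.ν.r (gOfRecord₁₃ F N θ.toStage13Params p j)) j)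
    (hR : ∀ j, 1 ≤ j → j ≤ p.K → (F.P p.K).L ^ j + (((F.P p.K).d + 4) * (F.P p.K).L + 2) * (∑ l ∈ Finset.range j, (F.P p.K).L ^ l) + 2 ≤
      cubeSide (F.P p.K).L θ.ν.M₂ (RkOfRecord (F.P p.K).L θ.ν.r (gOfRecord₁₃ F N θ.toStage13Params p j)) j)
    (hε : ∀ j, 1 ≤ j → j ≤ p.K → 0 < epsOfRecord θ.ν (gOfRecord₁₃ F N θ.toStage13Params p) j)
    (hε3 : ∀ j, 1 ≤ j → j ≤ p.K → (143 * (((((F.P p.K).d + 4 : ℕ) : ℝ)) ^ 2 / 4) ^ 2) * epsOfRecord θ.ν (gOfRecord₁₃ F N θ.toStage13Params p) j ≤ 1 / 3)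
    (hε2 : ∀ j, 1 ≤ j → j ≤ p.K →
      2 * epsOfRecord θ.ν (gOfRecord₁₃ F N θ.toStage13Params p) j ≤ 2 * ExpMeanLog.deltaSU (Fin N) / ((((F.P p.K).d + 4) * (F.P p.K).L : ℕ) : ℝ) ^ 2)
    (hsolv : ∀ j, 1 ≤ j → j ≤ p.K → ∀ (s : SeqOfRecord F θ.ν θ.τ9.M (gOfRecord₁₃ F N θ.toStage13Params p) p.K j) (V : GaugeField (F.P p.K) j (SU N)),
      chiSeqOfRecord F N θ.ν θ.τ9.M (gOfRecord₁₃ F N θ.toStage13Params p) p.K j s V ≠ 0 →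
      ∀ a ∈ cubesIn (fun a : ↥(cubeIndices (F.P p.K) (cubeSide (F.P p.K).L θ.ν.M₂ (RkOfRecord (F.P p.K).L θ.ν.r (gOfRecord₁₃ F N θ.toStage13Params p j)) j)) =>
          cubeEnl (F.P p.K) (cubeSide (F.P p.K).L θ.ν.M₂ (RkOfRecord (F.P p.K).L θ.ν.r (gOfRecord₁₃ F N θ.toStage13Params p j)) j) a 0) (s.Ω j),
        ∃ U₀, IsMinimizer (avOfRecord F N p.K) {U | PlaqSmall (θ.ν.εreg * (F.P p.K).eta j ^ 2) U}
          (Bj θ.ν.M₁ (cubeEnl (F.P p.K) (cubeSide (F.P p.K).L θ.ν.M₂ (RkOfRecord (F.P p.K).L θ.ν.r (gOfRecord₁₃ F N θ.toStage13Params p j)) j) a 4) j)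
          (avgFamily (avOfRecord F N p.K) (qsstarGIter0 j V)) U₀)
    (σ : Sect3Supplier θ p) (hσ : SupplierObligations θ p σ) (hσB : SupplierBorel θ p σ) : SupplyChainAt θ p :=
  ⟨σ, hσ, noExpansionObligation_of_gaussCert_of_supplierBorel_of_bgFacts_of_powM θ p hζ hq h hθ hM₁ hle hcR hw hbgs hdiv hMa h3 hR hε hε3 hε2 hsolv σ hσB⟩

end Obligation

end Summit.QuantumFields.YangMills.Theorems.BalabanUVNodesN11Sect3SupplyChainBorelBOfBgFacts

end
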